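import Mathlib.Analysis.Calculus.LocalExtr.Basic
import Mathlib.Analysis.InnerProductSpace.EuclideanDist
import Mathlib.Analysis.Normed.Module.Connected
import Literature.Geometry.Symplectic.SteinLiouville
import Literature.Geometry.Symplectic.SteinJConvexOpen
import Literature.Geometry.Symplectic.SteinOrientation
import Literature.Geometry.Symplectic.SteinDomainComponents
import Literature.Topology.FourManifolds.Cobordism
import Literature.Topology.FourManifolds.MorseExtrema
import HarnessLib

/-!
# The maximum principle for `J`-convex functions; every component of a Stein domain meets `∂W`

Topic `Literature/Geometry/Symplectic`; a brick of the (far from complete) proof of the named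
fact `Literature.Geometry.Symplectic.Eliashberg1990_steinFilling_sphere_three`
(`SteinFillingSphere.lean`, Eliashberg (1990), Thm. 5.1: a Stein domain bounded by `S³` is `B⁴`),
namely the step "`∂W ≅ S³` is connected, hence so is `W`", and more generally the pointwise
maximum principle behind it.  Everything is proved; no definitions, no named facts.

* (from `Literature/Topology/FourManifolds/MorseExtrema.lean`:
  `IsLocalMax.fderiv_fderiv_apply_self_nonpos`, the second-order necessary condition
  `D²f(y₀)(a, a) ≤ 0` at a local maximum of a `C²` function);
* `levi_apply_self_J_eq` — **the Levi form at an interior critical point, in the chart**: for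
  `φ` smooth, `J` preserving smooth vector fields with `J_{x₀}² = -1`, `x₀` an interior point
  with `d(φ ∘ c⁻¹)(c x₀) = 0` (`c` the chart at `x₀`, `f = φ ∘ c⁻¹`),
  `-dd^ℂφ_{x₀}(u, J u) = D²f(u, u) + D²f(J u, J u)`;
* `not_isLocalMax_of_levi_pos` — **a strictly `J`-convex function has no interior local
  maximum** (Eliashberg (1990), §1.1: `J`-convex = strictly subharmonic on `J`-curves; here in
  the tree's chart-wise rendering `SteinStructure.convex` of `SteinDomain.lean`);
* `SteinStructure.isBoundaryPoint_of_isLocalMax`,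
  `SteinStructure.exists_isBoundaryPoint_mem_connectedComponent` — every local maximum of the
  `J`-convex function of a Stein structure, in particular the maximum over any connected
  component, is a boundary point; so **every connected component of a Stein domain meets the
  boundary** (closed components are excluded);
* `SteinStructure.preconnectedSpace_of_isPreconnected_boundary`,
  `SteinStructure.connectedSpace_of_connectedSpace_boundaryData`,
  `SteinStructure.connectedSpace_of_boundary_diffeomorph_sphere` — hence **a Stein domain with
  connected boundary is connected**, in particular a Stein filling of `S³` (the `W` of
  `Eliashberg1990_steinFilling_sphere_three`) is connected.

## References

* Ya. Eliashberg, *Filling by holomorphic discs and its applications*, LMS Lecture Note Ser. 151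
  (1990), §1.1 (`J`-convex functions and hypersurfaces), Thm. 5.1. [Eliashberg1990]
* K. Cieliebak, Ya. Eliashberg, *From Stein to Weinstein and back*, AMS Coll. Publ. 59 (2012),
  Ch. 2 (`J`-convex functions; maximum principle). [CieliebakEliashberg2012]
-/

noncomputable section

open scoped Manifold ContDiff Topology
open Set Filter

namespace Literature.Geometry.Symplectic

open Literature.Geometry.Kaehler

/-! ### Flat preliminaries -/

section Flat

variable {E : Type*} [NormedAddCommGroup E] [NormedSpace ℝ E]
  {F : Type*} [NormedAddCommGroup F] [NormedSpace ℝ F]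

/-- `Fin.removeNth 1 (a, b) = (a)` (companion of Mathlib's `Fin.removeNth_zero`). [folklore] -/
theorem removeNth_one_pair {α : Type*} (a b : α) : Fin.removeNth 1 ![a, b] = ![a] := by
  funext j
  fin_cases j
  rfl

/-- Mathlib's exterior derivative of a `1`-form on a pair of vectors:
`dβ(a, b) = Dβ(a)(b) - Dβ(b)(a)`. [folklore] -/
theorem extDeriv_apply_pair {β : E → E [⋀^Fin 1]→L[ℝ] F} {y : E} (hβ : DifferentiableAt ℝ β y)
    (a b : E) : extDeriv β y ![a, b] = fderiv ℝ β y a ![b] - fderiv ℝ β y b ![a] := by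
  rw [extDeriv_apply hβ, Fin.sum_univ_succ, Fin.sum_univ_one]
  simp [fderiv_continuousAlternatingMap_apply_const_apply hβ, removeNth_one_pair, sub_eq_add_neg]

/-- At a point of which `s` is a neighbourhood, `extDerivWithin _ s` is `extDeriv`. [folklore] -/
theorem extDerivWithin_eq_extDeriv_of_mem_nhds {n : ℕ} (β : E → E [⋀^Fin n]→L[ℝ] F) {s : Set E}
    {y : E} (h : s ∈ 𝓝 y) : extDerivWithin β s y = extDeriv β y := by
  simp only [extDerivWithin, extDeriv, fderivWithin_of_mem_nhds h]

end Flat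

/-! ### The Levi form at an interior critical point -/

section Levi

variable {W : Type*} [TopologicalSpace W] [T2Space W] [ChartedSpace (EuclideanHalfSpace 4) W]
  [IsManifold (𝓡∂ 4) ∞ W] {J : (x : W) → (EuclideanSpace ℝ (Fin 4) →L[ℝ] EuclideanSpace ℝ (Fin 4))}

omit [T2Space W] [IsManifold (𝓡∂ 4) ∞ W] in
/-- For an interior point `x₀`, the target of the chart at `x₀` and `range (𝓡∂ 4)` are
neighbourhoods of `c x₀`. [folklore] -/
theorem extChartAt_target_mem_nhds_of_isInteriorPoint {x₀ : W} (hx₀ : (𝓡∂ 4).IsInteriorPoint x₀) :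
    (extChartAt (𝓡∂ 4) x₀).target ∈ 𝓝 (extChartAt (𝓡∂ 4) x₀ x₀) ∧
      range (𝓡∂ 4) ∈ 𝓝 (extChartAt (𝓡∂ 4) x₀ x₀) :=
  ⟨mem_interior_iff_mem_nhds.1 ((𝓡∂ 4).isInteriorPoint_iff.1 hx₀), mem_interior_iff_mem_nhds.1 hx₀⟩

/-- **The Levi form at an interior critical point, read in the chart.**  Let `φ` be smooth, `J`
preserve smooth vector fields with `J_{x₀}² = -1`, `x₀` an interior point, `c` the chart at
`x₀`, `f = φ ∘ c⁻¹`, and suppose `Df(c x₀) = 0`.  Then for every `u`,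
`-dd^ℂφ_{x₀}(u, J_{x₀} u) = D²f(c x₀)(u)(u) + D²f(c x₀)(J u)(J u)`: in the chart
`(d^ℂφ)^ y (w) = Df_y(Ĵ_y w)` (`inChart_dComplex_apply`), so
`d(d^ℂφ)^(u, w) = D²f(u)(Ĵ w) - D²f(w)(Ĵ u) + Df(…)`, the last term vanishing at a critical
point, and `Ĵ_{c x₀} = J_{x₀}` (`JTriv_self`, `SteinOrientation.lean`) with `J² = -1`. [folklore] -/
theorem levi_apply_self_J_eq (hJ : PreservesSmoothFields J) {φ : W → ℝ}
    (hφ : ContMDiff (𝓡∂ 4) 𝓘(ℝ, ℝ) ∞ φ) {x₀ : W} (hx₀ : (𝓡∂ 4).IsInteriorPoint x₀)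
    (hJsq : ∀ v : EuclideanSpace ℝ (Fin 4), J x₀ (J x₀ v) = -v)
    (hcrit : fderiv ℝ (φ ∘ (extChartAt (𝓡∂ 4) x₀).symm) (extChartAt (𝓡∂ 4) x₀ x₀) = 0)
    (u : EuclideanSpace ℝ (Fin 4)) :
    -(mextDeriv (dComplex J φ) x₀ ![u, J x₀ u]) =
      fderiv ℝ (fderiv ℝ (φ ∘ (extChartAt (𝓡∂ 4) x₀).symm)) (extChartAt (𝓡∂ 4) x₀ x₀) u u +
      fderiv ℝ (fderiv ℝ (φ ∘ (extChartAt (𝓡∂ 4) x₀).symm)) (extChartAt (𝓡∂ 4) x₀ x₀)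
        (J x₀ u) (J x₀ u) := by
  set c := extChartAt (𝓡∂ 4) x₀ with hc
  set y₀ : EuclideanSpace ℝ (Fin 4) := c x₀ with hy₀
  set f : EuclideanSpace ℝ (Fin 4) → ℝ := φ ∘ c.symm with hf
  set JT : EuclideanSpace ℝ (Fin 4) → (EuclideanSpace ℝ (Fin 4) →L[ℝ] EuclideanSpace ℝ (Fin 4)) :=
    fun y => JTriv J x₀ (c.symm y) with hJT
  set α := dComplex J φ with hα
  obtain ⟨hT, hR⟩ := extChartAt_target_mem_nhds_of_isInteriorPoint hx₀
  have hyx : c.symm y₀ = x₀ := extChartAt_to_inv x₀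
  -- smoothness of the ingredients near `y₀`
  have hfT : ContDiffOn ℝ ∞ f c.target :=
    contMDiffOn_iff_contDiffOn.1 (hφ.comp_contMDiffOn (contMDiffOn_extChartAt_symm x₀))
  have hfy : ContDiffAt ℝ ∞ f y₀ := hfT.contDiffAt hT
  have hJTs : ∀ w : EuclideanSpace ℝ (Fin 4), ContDiffOn ℝ ∞ (fun y => JT y w) c.target := by
    intro w
    have h1 : ContMDiffOn (𝓡∂ 4) 𝓘(ℝ, EuclideanSpace ℝ (Fin 4)) ∞ (fun x => JTriv J x₀ x w)
        (chartAt (EuclideanHalfSpace 4) x₀).source := fun x hx =>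
      (contMDiffAt_JTriv hJ x₀ w hx).contMDiffWithinAt
    have h2 : ContMDiffOn 𝓘(ℝ, EuclideanSpace ℝ (Fin 4)) 𝓘(ℝ, EuclideanSpace ℝ (Fin 4)) ∞
        (fun y => JTriv J x₀ (c.symm y) w) c.target :=
      h1.comp (contMDiffOn_extChartAt_symm x₀) fun y hy => by
        rw [← extChartAt_source (𝓡∂ 4)]; exact c.map_target hy
    exact contMDiffOn_iff_contDiffOn.1 h2
  have hJTy : ∀ w : EuclideanSpace ℝ (Fin 4), DifferentiableAt ℝ (fun y => JT y w) y₀ := fun w =>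
    ((hJTs w).contDiffAt hT).differentiableAt (by simp)
  have hDf : DifferentiableAt ℝ (fderiv ℝ f) y₀ :=
    (hfy.fderiv_right (m := 1) (WithTop.coe_le_coe.2 le_top)).differentiableAt (by simp)
  have hsm : IsSmoothForm α := isSmoothForm_dComplex_of_preservesSmoothFields hJ hφ
  have hαy : DifferentiableAt ℝ (α.inChart x₀) y₀ :=
    ((hsm x₀).contDiffAt hR).differentiableAt (by simp)
  -- the chart representative of `d^ℂφ` near `y₀`: `α̂ y (V) = Df_y (Ĵ_y (V 0))`
  have hrep : ∀ w : EuclideanSpace ℝ (Fin 4), (fun y => α.inChart x₀ y ![w]) =ᶠ[𝓝 y₀]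
      fun y => fderiv ℝ f y (JT y w) := by
    intro w
    filter_upwards [interior_mem_nhds.2 hT] with y hy
    have hy' : y ∈ c.target := interior_subset hy
    rw [hα, inChart_dComplex_apply hφ x₀ hy',
      fderivWithin_of_mem_nhds (mem_interior_iff_mem_nhds.1 hy)]
    rfl
  -- derivative of the representative at `y₀` in direction `a`, evaluated on `w`
  have hD : ∀ a w : EuclideanSpace ℝ (Fin 4), fderiv ℝ (α.inChart x₀) y₀ a ![w] =
      fderiv ℝ (fderiv ℝ f) y₀ a (J x₀ w) := by
    intro a w
    rw [← fderiv_continuousAlternatingMap_apply_const_apply hαy ![w] a, (hrep w).fderiv_eq,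
      fderiv_clm_apply hDf (hJTy w), hcrit]
    simp only [ContinuousLinearMap.zero_comp, zero_add, ContinuousLinearMap.flip_apply]
    show fderiv ℝ (fderiv ℝ f) y₀ a (JTriv J x₀ (c.symm y₀) w) = _
    rw [hyx, JTriv_self]
  -- `dd^ℂφ_{x₀} = d(α̂)(y₀)` and the evaluation
  have hdd : mextDeriv α x₀ ![u, J x₀ u] = extDeriv (α.inChart x₀) y₀ ![u, J x₀ u] := by
    rw [mextDeriv_eq_extDerivWithin, extDerivWithin_eq_extDeriv_of_mem_nhds _ hR]
    rfl
  rw [hdd, extDeriv_apply_pair hαy, hD, hD, hJsq, map_neg]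
  ring

/-- **A strictly `J`-convex function has no interior local maximum** (the maximum principle;
Eliashberg (1990), §1.1: `J`-convex functions are strictly subharmonic on `J`-holomorphic
curves).  Tree rendering: `φ` smooth, `J` preserving smooth vector fields with `J_{x₀}² = -1`,
`x₀` an interior point at which the Levi form `-dd^ℂφ_{x₀}(v, J v)` is positive for `v ≠ 0`;
then `x₀` is not a local maximum of `φ`.  At a local maximum `Df = 0` and `D²f(a, a) ≤ 0`
(`Literature.Topology.FourManifolds.IsLocalMax.fderiv_fderiv_apply_self_nonpos`), so by
`levi_apply_self_J_eq` the Levi form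
would be `≤ 0`. [folklore] -/
theorem not_isLocalMax_of_levi_pos (hJ : PreservesSmoothFields J) {φ : W → ℝ}
    (hφ : ContMDiff (𝓡∂ 4) 𝓘(ℝ, ℝ) ∞ φ) {x₀ : W} (hx₀ : (𝓡∂ 4).IsInteriorPoint x₀)
    (hJsq : ∀ v : EuclideanSpace ℝ (Fin 4), J x₀ (J x₀ v) = -v)
    (hconv : ∀ v : EuclideanSpace ℝ (Fin 4), v ≠ 0 →
      0 < -(mextDeriv (dComplex J φ) x₀ ![v, J x₀ v])) :
    ¬ IsLocalMax φ x₀ := by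
  intro hmax
  set c := extChartAt (𝓡∂ 4) x₀ with hc
  obtain ⟨hT, -⟩ := extChartAt_target_mem_nhds_of_isInteriorPoint hx₀
  have hyx : c.symm (c x₀) = x₀ := extChartAt_to_inv x₀
  -- `f = φ ∘ c⁻¹` has a local maximum at `c x₀`
  have hmax' : IsLocalMax (φ ∘ c.symm) (c x₀) := by
    have h : IsLocalMax φ (c.symm (c x₀)) := by rw [hyx]; exact hmax
    exact h.comp_continuous (continuousAt_extChartAt_symm x₀)
  have hfT : ContDiffOn ℝ ∞ (φ ∘ c.symm) c.target :=
    contMDiffOn_iff_contDiffOn.1 (hφ.comp_contMDiffOn (contMDiffOn_extChartAt_symm x₀))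
  have hf2 : ContDiffAt ℝ 2 (φ ∘ c.symm) (c x₀) :=
    (hfT.contDiffAt hT).of_le (WithTop.coe_le_coe.2 le_top)
  -- a non-zero vector
  set u : EuclideanSpace ℝ (Fin 4) := EuclideanSpace.single 0 1 with hu
  have hu0 : u ≠ 0 := by
    intro h
    have := congrArg (fun v : EuclideanSpace ℝ (Fin 4) => v 0) h
    simp [hu] at this
  have key := levi_apply_self_J_eq hJ hφ hx₀ hJsq hmax'.fderiv_eq_zero u
  have h1 :=
    Literature.Topology.FourManifolds.IsLocalMax.fderiv_fderiv_apply_self_nonpos hf2 hmax' u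
  have h2 :=
    Literature.Topology.FourManifolds.IsLocalMax.fderiv_fderiv_apply_self_nonpos hf2 hmax' (J x₀ u)
  have h3 := hconv u hu0
  linarith

end Levi

/-! ### Stein domains: every component meets the boundary -/

section Stein

variable {W : Type*} [TopologicalSpace W] [T2Space W] [ChartedSpace (EuclideanHalfSpace 4) W]
  [IsManifold (𝓡∂ 4) ∞ W] [CompactSpace W]

namespace SteinStructure

/-- **The `J`-convex function of a Stein structure has no interior local maximum.** [folklore] -/
theorem not_isLocalMax_of_isInteriorPoint (S : SteinStructure W) {x : W}
    (hx : (𝓡∂ 4).IsInteriorPoint x) : ¬ IsLocalMax S.φ x :=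
  not_isLocalMax_of_levi_pos S.preservesSmoothFields S.φ_smooth hx (S.J_sq x)
    (fun v hv => S.convex x v hv)

/-- Every local maximum of the `J`-convex function of a Stein structure is a boundary point.
[folklore] -/
theorem isBoundaryPoint_of_isLocalMax (S : SteinStructure W) {x : W} (h : IsLocalMax S.φ x) :
    (𝓡∂ 4).IsBoundaryPoint x := by
  by_contra hb
  exact S.not_isLocalMax_of_isInteriorPoint
    (((𝓡∂ 4).isInteriorPoint_iff_not_isBoundaryPoint x).2 hb) h

/-- **Every connected component of a Stein domain meets the boundary**: the maximum of `φ`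
over the (compact, open) component is a local maximum of `φ`, hence a boundary point.  In
particular a Stein domain has no closed components. [folklore] -/
theorem exists_isBoundaryPoint_mem_connectedComponent (S : SteinStructure W) (x : W) :
    ∃ y ∈ connectedComponent x, (𝓡∂ 4).IsBoundaryPoint y := by
  haveI := locallyConnectedSpace_of_chartedSpace W
  have hC : IsCompact (connectedComponent x) := isClosed_connectedComponent.isCompact
  obtain ⟨y, hy, hmax⟩ :=
    hC.exists_isMaxOn ⟨x, mem_connectedComponent⟩ S.φ_smooth.continuous.continuousOn
  exact ⟨y, hy, S.isBoundaryPoint_of_isLocalMax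
    (hmax.isLocalMax (isOpen_connectedComponent.mem_nhds hy))⟩

/-- **A Stein domain with preconnected boundary is preconnected**: every component contains a
boundary point, and the boundary lies in a single component. [folklore] -/
theorem preconnectedSpace_of_isPreconnected_boundary (S : SteinStructure W)
    (h : IsPreconnected ((𝓡∂ 4).boundary W)) : PreconnectedSpace W := by
  refine preconnectedSpace_iff_connectedComponent.2 fun x => ?_
  refine eq_univ_of_forall fun x' => ?_
  obtain ⟨b, hb, hbb⟩ := S.exists_isBoundaryPoint_mem_connectedComponent x
  obtain ⟨b', hb', hbb'⟩ := S.exists_isBoundaryPoint_mem_connectedComponent x'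
  -- the boundary is contained in the component of `b`
  have hsub : (𝓡∂ 4).boundary W ⊆ connectedComponent b := h.subset_connectedComponent hbb
  have h1 : connectedComponent x = connectedComponent b := connectedComponent_eq hb
  have h2 : connectedComponent x' = connectedComponent b' := connectedComponent_eq hb'
  have h3 : b' ∈ connectedComponent b := hsub hbb'
  have h4 : connectedComponent b = connectedComponent b' := connectedComponent_eq h3
  rw [h1, h4, ← h2]
  exact mem_connectedComponent

/-- **A Stein domain whose boundary manifold is connected is connected** (boundary manifold in
the sense of a boundary datum `Literature.Topology.FourManifolds.BoundaryData`: the boundary is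
the continuous image of the connected carrier). [folklore] -/
theorem connectedSpace_of_connectedSpace_boundaryData (S : SteinStructure W)
    (b : Literature.Topology.FourManifolds.BoundaryData (𝓡∂ 4) W (𝓡 3))
    [ConnectedSpace b.carrier] : ConnectedSpace W := by
  have hconn : IsConnected ((𝓡∂ 4).boundary W) := by
    rw [← b.range_incl]
    exact isConnected_range b.continuous_incl
  haveI : PreconnectedSpace W := S.preconnectedSpace_of_isPreconnected_boundary hconn.isPreconnected
  exact ConnectedSpace.mk (toPreconnectedSpace := ‹_›) ⟨b.incl (Classical.arbitrary b.carrier)⟩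

/-- **A Stein filling of `S³` is connected**: the `W` of
`Literature.Geometry.Symplectic.Eliashberg1990_steinFilling_sphere_three` — a compact Stein
domain with a boundary datum diffeomorphic to the round `S³ ⊂ ℝ⁴` — is connected (the step
"`Ω` is connected" implicit in Eliashberg (1990), Thm. 5.1, where `Ω` is a domain).
[cite: Eliashberg1990, Thm. 5.1] -/
theorem connectedSpace_of_boundary_diffeomorph_sphere (S : SteinStructure W)
    (b : Literature.Topology.FourManifolds.BoundaryData (𝓡∂ 4) W (𝓡 3))
    (e : b.carrier ≃ₘ⟮𝓡 3, 𝓡 3⟯ (Metric.sphere (0 : EuclideanSpace ℝ (Fin 4)) 1)) :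
    ConnectedSpace W := by
  have hrank : 1 < Module.rank ℝ (EuclideanSpace ℝ (Fin 4)) := by
    rw [← Module.finrank_eq_rank, finrank_euclideanSpace, Fintype.card_fin]
    norm_num
  haveI : ConnectedSpace (Metric.sphere (0 : EuclideanSpace ℝ (Fin 4)) 1) :=
    isConnected_iff_connectedSpace.1 (isConnected_sphere hrank 0 zero_le_one)
  haveI : ConnectedSpace b.carrier := e.toHomeomorph.symm.surjective.connectedSpace
    e.toHomeomorph.symm.continuous
  exact S.connectedSpace_of_connectedSpace_boundaryData b

end SteinStructure

end Stein

end Literature.Geometry.Symplectic
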